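import Summits.Ventures.YMGap.RobustBall.UniformMassGap
import Summits.Ventures.YMGap.RobustBall.LoopSourceScreening
import Literature.Probability.LatticeModels.GibbsMeasuresLocalTilt
import HarnessLib

/-!
# Venture YMGap, track ROBUST-BALL (Y2) — TIER 2: LOCAL SOURCES CREATE NO PHASES ON THE WEIGHTED (INFINITE-RANGE)
# BALL, and the exact response identity for the summable specification

HONEST FRAMING. WHAT THIS IS: a venture file (cell `pub-ymgap`, track Y2 ROBUST-BALL, seat rb-p1, theorems only): the TIER-2
twin of `LocalSourceOneState.lean`.  There the member `W` was listed by finite support families (`perturbedYM ρ β W supp`);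
here `W` is an arbitrary LINK-SUMMABLE potential (`IsLinkSummable W B`: infinitely many terms through every link, e.g. the
loop-action norm ball of all rectangles / all closed trails, the axial-pair and isotropic-pair witnesses) and the
specification is the summable one, `perturbedYMS ρ β W` (`SummableSpecification.lean`).  For ANY source `V` with
continuous own-link terms listed by `suppV` inside a finite catalogue `T` (`suppV Λ ⊆ T`; total source energy
`H^V = Σ_{A ∈ T} V_A`, ANY strength):
* `perturbedEnergyS_add_eq` / `perturbedYMS_add_eq_tilted_hamiltonianIn` — the summable energy of `W + V` in `Λ` is that of
  `W` minus `H^V_Λ`, so the kernel of `W + V` in `Λ` is the kernel of `W` tilted by `−H^V_Λ` (Mathlib `tilted_tilted`);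
* `perturbedGibbsMeasuresS_add_bijOn_tilted` — `μ ↦ μ.tilted (−H^V)` is a BIJECTION from the DLR states of `W` onto
  those of `W + V` (Literature `gibbsMeasures_bijOn_tilted`, Föllmer 1988 Ch. I (2.13)); `perturbedGibbsMeasuresS_add_eq_image`;
* `hasUniqueGibbsMeasureS_add_iff` — A BOUNDED LOCAL SOURCE OF ANY STRENGTH NEITHER CREATES NOR DESTROYS A PHASE of a
  tier-2 member; `eq_tilted_of_mem_perturbedGibbsMeasuresS_add`, `integral_eq_div_of_mem_perturbedGibbsMeasuresS_add`,
  `integral_sub_integral_eq_cov_div_S` — when `W` has at most one DLR state `μ`, every DLR state of `W + V` IS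
  `μ.tilted (−H^V)` and the response `∫F dν − ∫F dμ = cov_μ(e^{−H^V}, F)/μ(e^{−H^V})` is an UNPERTURBED covariance
  (the infinite-volume fluctuation–response identity, exact in the source);
* ON THE BALLS: every member of the weighted ball `MemBallZdS a Λ t` carrying the tier-2 mass gap
  (`MassGapOnBallZdS`, `UniformMassGapOnBallZdS`) keeps EXACTLY ONE DLR state under every such source
  (`hasUniqueGibbsMeasure_add_of_massGapOnBallZdS`, `…_of_uniformMassGapOnBallZdS`; `SU(2)` `ℤ⁴` schema
  `su2_tier2_add_source_hasUniqueGibbsMeasure_dim4`);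
* (the loop-action norm ball plus finitely many loops of any strength: `LocalSourceLoops.lean`.)
WHAT THIS IS NOT: nothing about sources with infinitely many terms (a changed coupling on all of `ℤ^d` IS a different
phase diagram); no decay estimate (those are `LocalSourceScreeningS.lean` / `LoopSourceScreeningS.lean`); lattice only,
strong coupling only (the rows), nothing about the continuum limit or a Clay-sense mass gap.
-/

noncomputable section

open MeasureTheory Function Finset Real
open Literature.Probability.LatticeModels
open Literature.MathematicalPhysics.QuantumLattice
open Literature.MathematicalPhysics.QuantumFieldTheory hiding ZdEdge Site

namespace Summit.Ventures.YMGap.RobustBall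

variable {d N : ℕ}

section General

variable {G : Type*} [Group G] [TopologicalSpace G] [IsTopologicalGroup G] [CompactSpace G]
  [MeasurableSpace G] [BorelSpace G] [SecondCountableTopology G] [T2Space G] (ρ : G →* Matrix (Fin N) (Fin N) ℂ)

omit [Group G] [TopologicalSpace G] [IsTopologicalGroup G] [CompactSpace G] [MeasurableSpace G] [BorelSpace G]
  [SecondCountableTopology G] [T2Space G] in
/-- A potential with bounded terms listed by finite support families has a summable link majorant (only the finitely many
listed sets through a link carry nonzero terms). -/
theorem isLinkSummable_of_supportedBy {V : Potential (ZdEdge d) G} (hVb : ∀ X, ∃ C, ∀ U, |V X U| ≤ C)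
    {suppV : Finset (ZdEdge d) → Finset (Finset (ZdEdge d))} (hsuppV : V.IsSupportedBy suppV) :
    ∃ B, IsLinkSummable V B := by
  classical
  choose C hC using hVb
  refine ⟨fun X => if V X = 0 then 0 else C X, ⟨fun X U => ?_, fun e => ?_⟩⟩
  · split_ifs with h0
    · simp [h0]
    · exact hC X U
  · refine summable_of_ne_finset_zero (s := suppV {e}) fun X hX => ?_
    split_ifs with heX h0
    · rfl
    · exact absurd (hsuppV {e} X ⟨e, Finset.mem_inter.2 ⟨heX, Finset.mem_singleton_self e⟩⟩ h0) hX
    · rfl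

omit [Group G] [TopologicalSpace G] [IsTopologicalGroup G] [CompactSpace G] [MeasurableSpace G] [BorelSpace G]
  [SecondCountableTopology G] [T2Space G] in
/-- Summable link majorants add (general structure group; the `SU(N)` copy is `IsLinkSummable.add`). -/
theorem IsLinkSummable.add' {W V : Potential (ZdEdge d) G} {B₁ B₂ : Finset (ZdEdge d) → ℝ} (h₁ : IsLinkSummable W B₁)
    (h₂ : IsLinkSummable V B₂) : IsLinkSummable (W + V) (B₁ + B₂) := by
  refine ⟨fun X U => ?_, fun e => ?_⟩
  · simp only [Pi.add_apply]
    exact (abs_add_le _ _).trans (add_le_add (h₁.abs_le X U) (h₂.abs_le X U))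
  · have h := (h₁.summable e).add (h₂.summable e)
    refine h.congr fun X => ?_
    simp only [Pi.add_apply]
    split_ifs <;> ring

omit [Group G] [TopologicalSpace G] [IsTopologicalGroup G] [CompactSpace G] [MeasurableSpace G] [BorelSpace G]
  [SecondCountableTopology G] [T2Space G] in
/-- For a potential listed by finite support families, the series of the terms meeting `Λ` is the finite-volume Hamiltonian
`H^V_Λ` (Georgii 2011, (2.11)). -/
theorem tsum_ite_eq_hamiltonianIn {V : Potential (ZdEdge d) G} {suppV : Finset (ZdEdge d) → Finset (Finset (ZdEdge d))}
    (hsuppV : V.IsSupportedBy suppV) (Λ : Finset (ZdEdge d)) (U : LGConfig d G) :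
    ∑' X : Finset (ZdEdge d), (if (X ∩ Λ).Nonempty then V X U else 0) = hamiltonianIn V suppV Λ U := by
  classical
  unfold hamiltonianIn
  rw [Finset.sum_filter, tsum_eq_sum (s := suppV Λ) (fun X hX => ?_)]
  split_ifs with hXΛ
  · by_contra hne
    exact hX (hsuppV Λ X hXΛ fun h0 => hne (by rw [h0]; rfl))
  · rfl

omit [TopologicalSpace G] [IsTopologicalGroup G] [CompactSpace G] [MeasurableSpace G] [BorelSpace G]
  [SecondCountableTopology G] [T2Space G] in
/-- **The summable energy of `W + V` is that of `W` minus the source Hamiltonian**: for link-summable `W` and a source `V`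
with bounded terms listed by `suppV`, `E^S_Λ(W + V) = E^S_Λ(W) − H^V_Λ`. -/
theorem perturbedEnergyS_add_eq {W V : Potential (ZdEdge d) G} {B : Finset (ZdEdge d) → ℝ} (hW : IsLinkSummable W B)
    (hVb : ∀ X, ∃ C, ∀ U, |V X U| ≤ C) {suppV : Finset (ZdEdge d) → Finset (Finset (ZdEdge d))}
    (hsuppV : V.IsSupportedBy suppV) (β : ℝ) (Λ : Finset (ZdEdge d)) (U : LGConfig d G) :
    perturbedEnergyS ρ β (W + V) Λ U = perturbedEnergyS ρ β W Λ U - hamiltonianIn V suppV Λ U := by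
  classical
  haveI : Nonempty (LGConfig d G) := ⟨fun _ => 1⟩
  obtain ⟨BV, hV⟩ := isLinkSummable_of_supportedBy hVb hsuppV
  unfold perturbedEnergyS
  have hsplit : (fun X : Finset (ZdEdge d) => (if (X ∩ Λ).Nonempty then (W + V) X U else 0)) =
      fun X => (if (X ∩ Λ).Nonempty then W X U else 0) + (if (X ∩ Λ).Nonempty then V X U else 0) := by
    funext X
    split_ifs <;> simp [Pi.add_apply]
  rw [hsplit, (hW.summable_term Λ U).tsum_add (hV.summable_term Λ U), tsum_ite_eq_hamiltonianIn hsuppV Λ U]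
  ring

omit [T2Space G] in
/-- **The kernel of `W + V` in `Λ` is the kernel of `W` tilted by `−H^V_Λ`** (tier 2; Mathlib `tilted_tilted`). -/
theorem perturbedYMS_add_eq_tilted_hamiltonianIn (hρ : Continuous ρ) (β : ℝ) {W V : Potential (ZdEdge d) G}
    {B : Finset (ZdEdge d) → ℝ} (hW : IsLinkSummable W B) (hWc : ∀ X, Continuous (W X))
    (hVb : ∀ X, ∃ C, ∀ U, |V X U| ≤ C) {suppV : Finset (ZdEdge d) → Finset (Finset (ZdEdge d))}
    (hsuppV : V.IsSupportedBy suppV) (Λ : Finset (ZdEdge d)) (η : LGConfig d G) :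
    perturbedYMS ρ β (W + V) Λ η = (perturbedYMS ρ β W Λ η).tilted fun U => -hamiltonianIn V suppV Λ U := by
  have hE : perturbedEnergyS ρ β (W + V) Λ = perturbedEnergyS ρ β W Λ + fun U => -hamiltonianIn V suppV Λ U := by
    funext U
    simp only [Pi.add_apply]
    rw [perturbedEnergyS_add_eq ρ hW hVb hsuppV β Λ U]
    ring
  unfold perturbedYMS
  rw [hE]
  haveI : IsProbabilityMeasure ((Measure.pi fun _ : ↥Λ => haarProbability G).map (glueWith Λ · η)) :=
    Measure.isProbabilityMeasure_map (measurable_glueWith Λ η).aemeasurable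
  obtain ⟨C, hC⟩ := exists_abs_perturbedEnergyS_le ρ hρ β hW Λ
  have hint : Integrable (fun U => Real.exp (perturbedEnergyS ρ β W Λ U))
      ((Measure.pi fun _ : ↥Λ => haarProbability G).map (glueWith Λ · η)) :=
    Integrable.of_bound ((continuous_perturbedEnergyS ρ hρ β hW hWc Λ).measurable.exp).aestronglyMeasurable
      (Real.exp C) (ae_of_all _ fun U => by
        rw [Real.norm_eq_abs, abs_of_pos (Real.exp_pos _)]
        exact Real.exp_le_exp.2 (abs_le.1 (hC U)).2)
  exact (tilted_tilted hint _).symm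

omit [Group G] [TopologicalSpace G] [IsTopologicalGroup G] [CompactSpace G] [MeasurableSpace G] [BorelSpace G]
  [SecondCountableTopology G] [T2Space G] in
/-- A finite sum of own-link terms all of which avoid `Λ` does not depend on the links of `Λ`. -/
private theorem dependsOn_sum_compl' {V : Potential (ZdEdge d) G} (hV : ∀ X, DependsOn (V X) (↑X : Set (ZdEdge d)))
    (Λ : Finset (ZdEdge d)) (s : Finset (Finset (ZdEdge d))) (hs : ∀ A ∈ s, ¬(A ∩ Λ).Nonempty) :
    DependsOn (fun U => ∑ A ∈ s, V A U) ((↑Λ : Set (ZdEdge d))ᶜ) := by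
  intro U U' h
  refine Finset.sum_congr rfl fun A hA => hV A fun x hx => h x ?_
  intro hxΛ
  exact hs A hA ⟨x, Finset.mem_inter.2 ⟨Finset.mem_coe.1 hx, Finset.mem_coe.1 hxΛ⟩⟩

/-- **TIER 2 — THE DLR STATES OF `W + V` ARE THE TILTS OF THE DLR STATES OF `W`, A BIJECTION.** For a continuous
representation `ρ` of a compact second-countable group, any `β`, a link-summable potential `W` with continuous own-link terms,
and a source `V` with continuous own-link terms listed by `suppV` inside a finite catalogue `T`, the map
`μ ↦ μ.tilted (−Σ_{A ∈ T} V_A)` is a bijection `𝒢_S(W) → 𝒢_S(W + V)` of the DLR states of the SUMMABLE specifications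
(Literature `gibbsMeasures_bijOn_tilted`, Föllmer 1988 Ch. I (2.13)). -/
theorem perturbedGibbsMeasuresS_add_bijOn_tilted (hρ : Continuous ρ) (β : ℝ)
    {W : Potential (ZdEdge d) G} {B : Finset (ZdEdge d) → ℝ} (hW : IsLinkSummable W B) (hWc : ∀ X, Continuous (W X))
    (hWdep : ∀ X, DependsOn (W X) (↑X : Set (ZdEdge d)))
    {V : Potential (ZdEdge d) G} (hVc : ∀ X, Continuous (V X)) (hVdep : ∀ X, DependsOn (V X) (↑X : Set (ZdEdge d)))
    {suppV : Finset (ZdEdge d) → Finset (Finset (ZdEdge d))} (hsuppV : V.IsSupportedBy suppV)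
    {T : Finset (Finset (ZdEdge d))} (hT : ∀ Λ, suppV Λ ⊆ T) :
    Set.BijOn (fun μ : Measure (LGConfig d G) => μ.tilted fun U => -∑ A ∈ T, V A U)
      (perturbedGibbsMeasuresS ρ β W) (perturbedGibbsMeasuresS ρ β (W + V)) := by
  classical
  have hVb : ∀ X, ∃ C, ∀ U, |V X U| ≤ C := fun X => exists_bound_of_continuous (hVc X)
  obtain ⟨BV, hV⟩ := isLinkSummable_of_supportedBy hVb hsuppV
  have hγ : IsSpecification (perturbedYMS (d := d) ρ β W) := isSpecification_perturbedYMS ρ hρ β hW hWc hWdep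
  have hγ' : IsSpecification (perturbedYMS (d := d) ρ β (W + V)) :=
    isSpecification_perturbedYMS ρ hρ β (hW.add' hV) (fun X => (hWc X).add (hVc X)) fun X U U' h => by
      simp only [Pi.add_apply]
      rw [hWdep X h, hVdep X h]
  -- bounds for the source terms
  choose C hC using hVb
  have hVm : ∀ A, Measurable (V A) := fun A => (hVc A).measurable
  have hflocm : ∀ Λ : Finset (ZdEdge d), Measurable fun U : LGConfig d G => -hamiltonianIn V suppV Λ U :=
    fun Λ => (measurable_hamiltonianIn hVm suppV Λ).neg
  have hflocb : ∀ Λ : Finset (ZdEdge d), ∃ B, ∀ U : LGConfig d G, |(-hamiltonianIn V suppV Λ U)| ≤ B :=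
    fun Λ => ⟨_, fun U => by rw [abs_neg]; exact abs_hamiltonianIn_le (fun A U => hC A U) suppV Λ U⟩
  have hfm : Measurable fun U : LGConfig d G => -∑ A ∈ T, V A U :=
    (Finset.measurable_sum _ fun A _ => hVm A).neg
  have hfb : ∀ U : LGConfig d G, |(-∑ A ∈ T, V A U)| ≤ ∑ A ∈ T, C A := fun U => by
    rw [abs_neg]; exact (Finset.abs_sum_le_sum_abs _ _).trans (Finset.sum_le_sum fun A _ => hC A U)
  have hdiff : ∀ Λ : Finset (ZdEdge d), DependsOn (fun U : LGConfig d G =>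
      (-∑ A ∈ T, V A U) - (-hamiltonianIn V suppV Λ U)) ((↑Λ : Set (ZdEdge d))ᶜ) := by
    intro Λ
    have hsplit : ∀ U, (-∑ A ∈ T, V A U) - (-hamiltonianIn V suppV Λ U) =
        -∑ A ∈ T with ¬(A ∩ Λ).Nonempty, V A U := by
      intro U
      rw [hamiltonianIn_eq_sum_filter_of_subset hsuppV (hT Λ) U,
        ← Finset.sum_filter_add_sum_filter_not T (fun A => (A ∩ Λ).Nonempty) (fun A => V A U)]
      ring
    have hdep := dependsOn_sum_compl' hVdep Λ (T.filter fun A => ¬(A ∩ Λ).Nonempty)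
      (fun A hA => (Finset.mem_filter.1 hA).2)
    intro U U' h
    have key := hdep h
    simp only at key
    simp only [hsplit, key]
  exact gibbsMeasures_bijOn_tilted hγ hγ' hflocm hflocb hfm hfb hdiff
    (fun Λ η => perturbedYMS_add_eq_tilted_hamiltonianIn ρ hρ β hW hWc (fun X => ⟨C X, hC X⟩) hsuppV Λ η)

/-- **The DLR states of `W + V` as a set** (tier 2): the image of `𝒢_S(W)` under the tilt. -/
theorem perturbedGibbsMeasuresS_add_eq_image (hρ : Continuous ρ) (β : ℝ)
    {W : Potential (ZdEdge d) G} {B : Finset (ZdEdge d) → ℝ} (hW : IsLinkSummable W B) (hWc : ∀ X, Continuous (W X))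
    (hWdep : ∀ X, DependsOn (W X) (↑X : Set (ZdEdge d)))
    {V : Potential (ZdEdge d) G} (hVc : ∀ X, Continuous (V X)) (hVdep : ∀ X, DependsOn (V X) (↑X : Set (ZdEdge d)))
    {suppV : Finset (ZdEdge d) → Finset (Finset (ZdEdge d))} (hsuppV : V.IsSupportedBy suppV)
    {T : Finset (Finset (ZdEdge d))} (hT : ∀ Λ, suppV Λ ⊆ T) :
    perturbedGibbsMeasuresS ρ β (W + V) =
      (fun μ : Measure (LGConfig d G) => μ.tilted fun U => -∑ A ∈ T, V A U) '' perturbedGibbsMeasuresS ρ β W :=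
  (perturbedGibbsMeasuresS_add_bijOn_tilted ρ hρ β hW hWc hWdep hVc hVdep hsuppV hT).image_eq.symm

/-- **TIER 2 — A BOUNDED LOCAL SOURCE NEITHER CREATES NOR DESTROYS A PHASE**: `W + V` has exactly one DLR state iff `W` has. -/
theorem hasUniqueGibbsMeasureS_add_iff (hρ : Continuous ρ) (β : ℝ)
    {W : Potential (ZdEdge d) G} {B : Finset (ZdEdge d) → ℝ} (hW : IsLinkSummable W B) (hWc : ∀ X, Continuous (W X))
    (hWdep : ∀ X, DependsOn (W X) (↑X : Set (ZdEdge d)))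
    {V : Potential (ZdEdge d) G} (hVc : ∀ X, Continuous (V X)) (hVdep : ∀ X, DependsOn (V X) (↑X : Set (ZdEdge d)))
    {suppV : Finset (ZdEdge d) → Finset (Finset (ZdEdge d))} (hsuppV : V.IsSupportedBy suppV)
    {T : Finset (Finset (ZdEdge d))} (hT : ∀ Λ, suppV Λ ⊆ T) :
    HasUniqueGibbsMeasure (perturbedYMS (d := d) ρ β (W + V)) ↔ HasUniqueGibbsMeasure (perturbedYMS (d := d) ρ β W) := by
  have hbij := perturbedGibbsMeasuresS_add_bijOn_tilted ρ hρ β hW hWc hWdep hVc hVdep hsuppV hT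
  unfold HasUniqueGibbsMeasure
  change (perturbedGibbsMeasuresS ρ β (W + V)).Subsingleton ∧ (perturbedGibbsMeasuresS ρ β (W + V)).Nonempty ↔
    (perturbedGibbsMeasuresS ρ β W).Subsingleton ∧ (perturbedGibbsMeasuresS ρ β W).Nonempty
  rw [← hbij.image_eq]
  constructor
  · rintro ⟨hs, hn⟩
    exact ⟨fun μ₁ h₁ μ₂ h₂ => hbij.injOn h₁ h₂ (hs ⟨μ₁, h₁, rfl⟩ ⟨μ₂, h₂, rfl⟩), (Set.image_nonempty.1 hn)⟩
  · rintro ⟨hs, hn⟩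
    exact ⟨hs.image _, hn.image _⟩

/-- **THE PERTURBED STATE IS THE TILT** (tier 2): if `W` has at most one DLR state and `μ` is one, then EVERY DLR state `ν`
of `W + V` is `μ.tilted (−Σ_{A ∈ T} V_A)`. -/
theorem eq_tilted_of_mem_perturbedGibbsMeasuresS_add (hρ : Continuous ρ) (β : ℝ)
    {W : Potential (ZdEdge d) G} {B : Finset (ZdEdge d) → ℝ} (hW : IsLinkSummable W B) (hWc : ∀ X, Continuous (W X))
    (hWdep : ∀ X, DependsOn (W X) (↑X : Set (ZdEdge d)))
    {V : Potential (ZdEdge d) G} (hVc : ∀ X, Continuous (V X)) (hVdep : ∀ X, DependsOn (V X) (↑X : Set (ZdEdge d)))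
    {suppV : Finset (ZdEdge d) → Finset (Finset (ZdEdge d))} (hsuppV : V.IsSupportedBy suppV)
    {T : Finset (Finset (ZdEdge d))} (hT : ∀ Λ, suppV Λ ⊆ T)
    (huniq : (perturbedGibbsMeasuresS ρ β W).Subsingleton)
    {μ ν : Measure (LGConfig d G)} (hμ : μ ∈ perturbedGibbsMeasuresS ρ β W)
    (hν : ν ∈ perturbedGibbsMeasuresS ρ β (W + V)) :
    ν = μ.tilted fun U => -∑ A ∈ T, V A U := by
  have hbij := perturbedGibbsMeasuresS_add_bijOn_tilted ρ hρ β hW hWc hWdep hVc hVdep hsuppV hT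
  obtain ⟨μ', hμ', rfl⟩ := hbij.surjOn hν
  simp only [huniq hμ' hμ]

/-- **EXPECTATIONS IN THE PERTURBED STATE** (tier 2): under the hypotheses of
`eq_tilted_of_mem_perturbedGibbsMeasuresS_add`, `∫ F dν = (∫ e^{−H^V} F dμ)/(∫ e^{−H^V} dμ)` for every `F`. -/
theorem integral_eq_div_of_mem_perturbedGibbsMeasuresS_add (hρ : Continuous ρ) (β : ℝ)
    {W : Potential (ZdEdge d) G} {B : Finset (ZdEdge d) → ℝ} (hW : IsLinkSummable W B) (hWc : ∀ X, Continuous (W X))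
    (hWdep : ∀ X, DependsOn (W X) (↑X : Set (ZdEdge d)))
    {V : Potential (ZdEdge d) G} (hVc : ∀ X, Continuous (V X)) (hVdep : ∀ X, DependsOn (V X) (↑X : Set (ZdEdge d)))
    {suppV : Finset (ZdEdge d) → Finset (Finset (ZdEdge d))} (hsuppV : V.IsSupportedBy suppV)
    {T : Finset (Finset (ZdEdge d))} (hT : ∀ Λ, suppV Λ ⊆ T)
    (huniq : (perturbedGibbsMeasuresS ρ β W).Subsingleton)
    {μ ν : Measure (LGConfig d G)} (hμ : μ ∈ perturbedGibbsMeasuresS ρ β W)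
    (hν : ν ∈ perturbedGibbsMeasuresS ρ β (W + V)) (F : LGConfig d G → ℝ) :
    ∫ U, F U ∂ν = (∫ U, Real.exp (-∑ A ∈ T, V A U) * F U ∂μ) / ∫ U, Real.exp (-∑ A ∈ T, V A U) ∂μ := by
  rw [eq_tilted_of_mem_perturbedGibbsMeasuresS_add ρ hρ β hW hWc hWdep hVc hVdep hsuppV hT huniq hμ hν, integral_tilted,
    ← integral_div]
  refine integral_congr_ae (ae_of_all _ fun U => ?_)
  simp only [smul_eq_mul]
  ring

/-- **TIER 2 — RESPONSE = COVARIANCE (the fluctuation–response identity, exact in the source)**: under the same hypotheses,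
`∫ F dν − ∫ F dμ = cov_μ(e^{−H^V}, F)/μ(e^{−H^V})`. -/
theorem integral_sub_integral_eq_cov_div_S (hρ : Continuous ρ) (β : ℝ)
    {W : Potential (ZdEdge d) G} {B : Finset (ZdEdge d) → ℝ} (hW : IsLinkSummable W B) (hWc : ∀ X, Continuous (W X))
    (hWdep : ∀ X, DependsOn (W X) (↑X : Set (ZdEdge d)))
    {V : Potential (ZdEdge d) G} (hVc : ∀ X, Continuous (V X)) (hVdep : ∀ X, DependsOn (V X) (↑X : Set (ZdEdge d)))
    {suppV : Finset (ZdEdge d) → Finset (Finset (ZdEdge d))} (hsuppV : V.IsSupportedBy suppV)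
    {T : Finset (Finset (ZdEdge d))} (hT : ∀ Λ, suppV Λ ⊆ T)
    (huniq : (perturbedGibbsMeasuresS ρ β W).Subsingleton)
    {μ ν : Measure (LGConfig d G)} (hμ : μ ∈ perturbedGibbsMeasuresS ρ β W)
    (hν : ν ∈ perturbedGibbsMeasuresS ρ β (W + V)) (F : LGConfig d G → ℝ) :
    (∫ U, F U ∂ν) - ∫ U, F U ∂μ =
      ((∫ U, Real.exp (-∑ A ∈ T, V A U) * F U ∂μ) -
        (∫ U, Real.exp (-∑ A ∈ T, V A U) ∂μ) * ∫ U, F U ∂μ) / ∫ U, Real.exp (-∑ A ∈ T, V A U) ∂μ := by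
  haveI := (show IsGibbsMeasure _ μ from hμ).isProbabilityMeasure
  have hZ : 0 < ∫ U, Real.exp (-∑ A ∈ T, V A U) ∂μ := by
    choose C hC using fun X => exists_bound_of_continuous (hVc X)
    refine integral_exp_pos (Integrable.of_bound ?_ (Real.exp (∑ A ∈ T, C A)) (ae_of_all _ fun U => ?_))
    · exact (Finset.measurable_sum _ fun A _ => (hVc A).measurable).neg.exp.aestronglyMeasurable
    · rw [Real.norm_eq_abs, abs_of_pos (Real.exp_pos _)]
      refine Real.exp_le_exp.2 ?_
      have := (Finset.abs_sum_le_sum_abs (fun A => V A U) T).trans (Finset.sum_le_sum fun A _ => hC A U)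
      linarith [(abs_le.1 this).1]
  rw [integral_eq_div_of_mem_perturbedGibbsMeasuresS_add ρ hρ β hW hWc hWdep hVc hVdep hsuppV hT huniq hμ hν F]
  field_simp

end General

/-! ### The weighted ball: every member with the tier-2 mass gap keeps ONE state under every bounded local source -/

section Ball

variable {β a Λ t : ℝ} {W : Potential (ZdEdge d) (SUN N)}

/-- **A MEMBER WITH THE TIER-2 MASS GAP KEEPS ONE STATE UNDER EVERY BOUNDED LOCAL SOURCE**: if `W ∈ MemBallZdS a Λ t` has
`PerturbedMassGapAtS d N β W` (unique DLR state + clustering), then for every source `V` with continuous own-link terms and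
finitely many listed terms, the summable member `W + V` has EXACTLY ONE DLR state — the tilt of the member's state. -/
theorem hasUniqueGibbsMeasure_add_of_perturbedMassGapAtS (hW : MemBallZdS a Λ t W) (hgap : PerturbedMassGapAtS d N β W)
    {V : Potential (ZdEdge d) (SUN N)} (hVc : ∀ X, Continuous (V X)) (hVdep : ∀ X, DependsOn (V X) (↑X : Set (ZdEdge d)))
    {suppV : Finset (ZdEdge d) → Finset (Finset (ZdEdge d))} (hsuppV : V.IsSupportedBy suppV)
    {T : Finset (Finset (ZdEdge d))} (hT : ∀ Λ, suppV Λ ⊆ T) :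
    HasUniqueGibbsMeasure (perturbedYMS (d := d) (fundamentalRep (Fin N)) (N * β) (W + V)) := by
  haveI : SecondCountableTopology (Matrix (Fin N) (Fin N) ℂ) :=
    inferInstanceAs (SecondCountableTopology (Fin N → Fin N → ℂ))
  haveI : SecondCountableTopology (SUN N) := Topology.IsEmbedding.subtypeVal.secondCountableTopology
  obtain ⟨B, hB⟩ := hW.summable
  exact (hasUniqueGibbsMeasureS_add_iff (fundamentalRep (Fin N)) (continuous_fundamentalRep (Fin N)) (N * β) hB
    hW.continuous hW.dependsOn hVc hVdep hsuppV hT).2 hgap.1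

/-- **ON THE WEIGHTED BALL OF A TIER-2 ROW, LOCAL SOURCES CREATE NO PHASES**: `MassGapOnBallZdS d N β a Λ t` and
`W ∈ MemBallZdS a Λ t` give, for every bounded local source `V` as above, exactly one DLR state of `W + V`. -/
theorem hasUniqueGibbsMeasure_add_of_massGapOnBallZdS (h : MassGapOnBallZdS d N β a Λ t) (hW : MemBallZdS a Λ t W)
    {V : Potential (ZdEdge d) (SUN N)} (hVc : ∀ X, Continuous (V X)) (hVdep : ∀ X, DependsOn (V X) (↑X : Set (ZdEdge d)))
    {suppV : Finset (ZdEdge d) → Finset (Finset (ZdEdge d))} (hsuppV : V.IsSupportedBy suppV)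
    {T : Finset (Finset (ZdEdge d))} (hT : ∀ Λ, suppV Λ ⊆ T) :
    HasUniqueGibbsMeasure (perturbedYMS (d := d) (fundamentalRep (Fin N)) (N * β) (W + V)) :=
  hasUniqueGibbsMeasure_add_of_perturbedMassGapAtS hW (h W hW) hVc hVdep hsuppV hT

/-- The same from the UNIFORM tier-2 currency `UniformMassGapOnBallZdS d N β a Λ t m A`. -/
theorem hasUniqueGibbsMeasure_add_of_uniformMassGapOnBallZdS {m A : ℝ} (h : UniformMassGapOnBallZdS d N β a Λ t m A)
    (hW : MemBallZdS a Λ t W)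
    {V : Potential (ZdEdge d) (SUN N)} (hVc : ∀ X, Continuous (V X)) (hVdep : ∀ X, DependsOn (V X) (↑X : Set (ZdEdge d)))
    {suppV : Finset (ZdEdge d) → Finset (Finset (ZdEdge d))} (hsuppV : V.IsSupportedBy suppV)
    {T : Finset (Finset (ZdEdge d))} (hT : ∀ Λ, suppV Λ ⊆ T) :
    HasUniqueGibbsMeasure (perturbedYMS (d := d) (fundamentalRep (Fin N)) (N * β) (W + V)) :=
  hasUniqueGibbsMeasure_add_of_massGapOnBallZdS h.massGapOnBallZdS hW hVc hVdep hsuppV hT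

/-- **AND THE PERTURBED EXPECTATIONS ARE RATIOS OF UNPERTURBED ONES** (tier 2): for the member's DLR state `μ` and any DLR
state `ν` of `W + V`, `∫ F dν − ∫ F dμ = cov_μ(e^{−H^V}, F)/μ(e^{−H^V})`. -/
theorem integral_sub_integral_eq_cov_div_of_perturbedMassGapAtS (hW : MemBallZdS a Λ t W)
    (hgap : PerturbedMassGapAtS d N β W)
    {V : Potential (ZdEdge d) (SUN N)} (hVc : ∀ X, Continuous (V X)) (hVdep : ∀ X, DependsOn (V X) (↑X : Set (ZdEdge d)))
    {suppV : Finset (ZdEdge d) → Finset (Finset (ZdEdge d))} (hsuppV : V.IsSupportedBy suppV)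
    {T : Finset (Finset (ZdEdge d))} (hT : ∀ Λ, suppV Λ ⊆ T)
    {μ ν : Measure (LGConfig d (SUN N))}
    (hμ : μ ∈ perturbedGibbsMeasuresS (d := d) (fundamentalRep (Fin N)) (N * β) W)
    (hν : ν ∈ perturbedGibbsMeasuresS (d := d) (fundamentalRep (Fin N)) (N * β) (W + V))
    (F : LGConfig d (SUN N) → ℝ) :
    (∫ U, F U ∂ν) - ∫ U, F U ∂μ =
      ((∫ U, Real.exp (-∑ A ∈ T, V A U) * F U ∂μ) -
        (∫ U, Real.exp (-∑ A ∈ T, V A U) ∂μ) * ∫ U, F U ∂μ) / ∫ U, Real.exp (-∑ A ∈ T, V A U) ∂μ := by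
  haveI : SecondCountableTopology (Matrix (Fin N) (Fin N) ℂ) :=
    inferInstanceAs (SecondCountableTopology (Fin N → Fin N → ℂ))
  haveI : SecondCountableTopology (SUN N) := Topology.IsEmbedding.subtypeVal.secondCountableTopology
  obtain ⟨B, hB⟩ := hW.summable
  exact integral_sub_integral_eq_cov_div_S (fundamentalRep (Fin N)) (continuous_fundamentalRep (Fin N)) (N * β) hB
    hW.continuous hW.dependsOn hVc hVdep hsuppV hT hgap.1.1 hμ hν F

/-- **`SU(2)` ON `ℤ⁴`, THE TIER-2 SCHEMA**: whenever `6|β_W| e^{a} e^{t} + e^{a/2} √(2/3) Λ < 1` (`t > 0`; the row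
`su2_massGapOnBallZdS_dim4`), every member `W ∈ MemBallZdS a Λ t` at `β_W` (tree slot `β_W/4`) plus every bounded local source
`V` (continuous own-link terms, finitely many listed terms, ANY strength) has exactly one DLR state. -/
theorem su2_tier2_add_source_hasUniqueGibbsMeasure_dim4 {βW a Λ t : ℝ} (ht : 0 < t)
    (hρ : 6 * |βW| * (exp a * exp t) + exp (a / 2) * Real.sqrt (2 / 3) * Λ < 1)
    {W : Potential (ZdEdge 4) (SUN 2)} (hW : MemBallZdS a Λ t W)
    {V : Potential (ZdEdge 4) (SUN 2)} (hVc : ∀ X, Continuous (V X)) (hVdep : ∀ X, DependsOn (V X) (↑X : Set (ZdEdge 4)))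
    {suppV : Finset (ZdEdge 4) → Finset (Finset (ZdEdge 4))} (hsuppV : V.IsSupportedBy suppV)
    {T : Finset (Finset (ZdEdge 4))} (hT : ∀ Λ, suppV Λ ⊆ T) :
    HasUniqueGibbsMeasure (perturbedYMS (d := 4) (fundamentalRep (Fin 2)) (2 * (βW / 4)) (W + V)) :=
  hasUniqueGibbsMeasure_add_of_massGapOnBallZdS (su2_massGapOnBallZdS_dim4 ht hρ) hW hVc hVdep hsuppV hT

end Ball

end Summit.Ventures.YMGap.RobustBall

end
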